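import Summits.QuantumFields.YangMills.Theorems.BalabanUVNodesN15TwoGridConsistency
import Summits.QuantumFields.YangMills.Theorems.BalabanUVNodesN15AveragingStencil
import HarnessLib

/-!
# Route «BalabanUVNodes», node N15 = NE2, -a lane, part 37: THE TWO-GRID CONSISTENCY OF BAŁABAN's AVERAGING `Q_k` AND ITS ADJOINT `Q*_k` —
# `Q = Q^s∘A_μ(n)` (block average ∘ line filter) against the typed (1.18) matrix, `Q′^s∘P = Q^s`, `‖Q′(Pu) − Qu‖ ≤ Σ_ν‖(τ_ν−1)u‖`, `‖Q′*v − P(Q*v)‖ ≤ 2η‖v‖`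

Cell `pub-ymgap`, seat `pub-ymgap-dag-n15-a` (KNIT-BY-NAME, g11; D-0062; chair R424 venue; `bears_on: R4∕N15`); `--supports stmt-QuantumFields-19910 --as helper`.
Door (iv) of `HOME/pub-ymgap-dag-n15-a/DOOR-IV-PLAN.md` §7.2 (route R file R2b), over parts 34∕35 (`…N15TwoGridTransports` p490970, `…N15TwoGridConsistency` p494393)
and part 20 (`…N15AveragingStencil` p439751: the (1.18) stencil `QvOp_apply_eq`, the line weights `lineWeight`, `QvOp_re_eq_lineWeight`, `abs_lineWeight_pair_sub_le`).
In the resolvent identity `𝔇(G₀′, G₀) = −G₀′·(Δ₀′P̂₂ − PΔ₀)·G₀` for `Δ₀ = Δ + aQ*Q` (`G₀ = (Δ + aQ*Q)⁻¹`, [B5] (1.69) at `P = 0`; `B5Local114G0Torus.prop12Printed_famDiagTop`)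
the averaging part of the consistency operator is `a·(Q′*Q′P̂₂ − PQ*Q) = a·[Q′*Q′(P̂₂ − P) + Q′*(Q′P − Q) + (Q′* − PQ*)Q]`; part 35 bounds `(P̂₂ − P)u`; THIS FILE
supplies the other two differences and the sup-norm contractions `‖Q^s‖, ‖Q‖, ‖Q*‖ ≤ 1`, all as identities ∕ inequalities of ℝ-linear maps on real 1-forms, with
DICTIONARIES to b05's typed complex matrices `B5Block118.QvOp` (1.18) and `B5DeltaA169.QvAdj = n^{d+1}·Q_kᴴ` (so R3 can move between the `idef`∕`HasMaj` currency and the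
b05 operator algebra of `DeltaA`).  Method: `Q` FACTORS through the symbol calculus — `(Qu)(y, μ) = Q^s(ρ(a_μ(n))u)(y, μ)` (block average of the LINE FILTER of unit
length along the bond's own direction) — and on the fine lattice `a′_μ(L^mL^k) = a′_μ(L^m)·[(L^k)⁻¹Σ_s(s′_μ^{L^m})^s]` whose second factor is the coarse line filter pushed
through King's prolongation (part 35's intertwining calculus); `Q^s` sees through the prolongation exactly (`(L^m)^{d+1}` fine points over each coarse one, same unit block);
so `Q′P − Q = Q′^s∘(A′_μ(L^m) − 1)∘P∘A_μ(L^k)`, one coarse difference by part 35's `norm_symbOp_sA_sub_one_pull_le`.  `Q*` is part 20's two-block stencil, and the fine and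
coarse stencils differ by `≤ 1∕L^k` on the same two blocks.
CONTENTS.  §9 `tstep_eq_smul`.  §10 `qsOp` (block average onto unit bonds), `qsOp_apply`, `norm_qsOp_le`; **`qvRe`** (`Q` on real 1-forms := `Q^s∘ρ(a_μ(n))` read at
direction `μ`), `qvRe_apply`, `norm_qvRe_le`, ★ **`QvOp_mulVec_ofReal_re`** (dictionary: `Re(QvOp·u) = qvRe u`).  §11 ★ `qsOp_comp_pull` (`Q′^s∘P = Q^s`), `sum_range_mul_pow`,
`sA_unit_eq`, `symbOp_pushedLine_comp_pull`, ★★ **`qvRe_pull_sub_apply`** (the exact identity), ★★ **`norm_qvRe_pull_sub_le`** (`‖Q′(Pu) − Qu‖_∞ ≤ Σ_ν‖ρ(s_ν−1)u‖_∞`).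
§12 **`qvAdjRe`** (`Q*` := the line-weight stencil), `qvAdjRe_apply`, ★ **`QvAdj_mulVec_ofReal_re`** (dictionary), `sum_lineWeight` (`Σ_zθ = 1`), `norm_qvAdjRe_le`,
`exists_eq_bpt_blockOf`, ★★ **`norm_qvAdjRe_sub_pull_le`** (`‖Q′*v − P(Q*v)‖_∞ ≤ (2∕L^k)‖v‖_∞`).
Plumbing defs are DATA (three ℝ-linear maps `qsOp`, `qvRe`, `qvAdjRe`; no `Prop`-valued def); every theorem is [folklore] lattice algebra; the (1.18)∕(1.20) tags mark
which printed formula the objects transcribe, nothing printed is asserted.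
HONEST FRAMING ∕ LIMITS.  Finite-dimensional lattice algebra + sup-norm bookkeeping on finite tori; the `∂P∂*` (Landau projection) part of `Δ_a`, the Hölder (1.111) input and
the (3.42) entries of `G₀`∕`G` are the sequel R3, NOT here; no estimate of [B5]∕[B9]; nothing with a background; NOT Node 00; count-neutral (typed 28∕28 · discharged 5∕28
unchanged); NOT a discharge of N15 (object-bound; NE2⁺ NOT PRINTED); `U ≡ 1` torus MODEL; one finite T⁴ at fixed ε — NOT infinite volume, NOT OS on ℝ⁴, NOT a mass gap,
NOT Clay.
-/

noncomputable section

open scoped BigOperators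
open Finset

namespace Summit.QuantumFields.YangMills.BalabanUVNodes.N15.TwoGrid

open Literature.MathematicalPhysics.QuantumFieldTheory.Balaban1983to89
open Literature.MathematicalPhysics.QuantumFieldTheory.Balaban1983to89.T4EtaRateCoeffDefect (pull pull_apply fibre mem_fibre)
open Literature.MathematicalPhysics.QuantumFieldTheory.Balaban1983to89.B5Prop11Plancherel (Tor fine unitVec)
open Literature.MathematicalPhysics.QuantumFieldTheory.Balaban1983to89.B5Block118 (tstep tstep_zero tstep_succ bpt QvOp)
open Literature.MathematicalPhysics.QuantumFieldTheory.Balaban1983to89.B5DeltaA169 (QvAdj)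
open Summit.QuantumFields.YangMills.BalabanUVNodes.N15.DefectKernel (pr_bpt mem_fibre_blockOf_iff)
open Literature.MathematicalPhysics.QuantumFieldTheory.King1986.Torus (site site_eq_bpt)
open Literature.MathematicalPhysics.QuantumFieldTheory.King1986.Torus (blockOf val_blockOf blockOf_over)
open Literature.MathematicalPhysics.QuantumFieldTheory.Balaban1983to89.B6UnitTorusCarrier (card_fibre_blockOf)
open Summit.QuantumFields.YangMills.BalabanUVNodes.N15.VectorPiece (kingPr kingPrV kingPr_val kingPrV_eq QvOp_apply_eq lineWeight lineWeight_nonneg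
  QvOp_re_eq_lineWeight abs_lineWeight_pair_sub_le)

variable {d : ℕ}

/-! ## §9 The straight contour steps are multiples of the unit vector -/

section Steps

variable (N : Fin (d + 1) → ℕ)

/-- b05's `tstep N μ t` IS `t • e_μ`. [folklore] -/
theorem tstep_eq_smul (μ : Fin (d + 1)) (t : ℕ) : tstep N μ t = t • unitVec N μ := by
  induction t with
  | zero => rw [tstep_zero, zero_smul]
  | succ t ih => rw [tstep_succ, ih, add_smul, one_smul]

end Steps

/-! ## §10 The block average of fine 1-forms onto unit bonds, and Bałaban's `Q_k` (1.18) as «block average ∘ line filter» -/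

section BlockAverage

variable (M : Fin (d + 1) → ℕ) [∀ μ, NeZero (M μ)] (n : ℕ) [NeZero n]

/-- THE BLOCK AVERAGE onto unit bonds: `(Q^s f)(y, a) = n^{−(d+1)} Σ_{x ∈ B(y)} f(x, a)` (Bałaban's scalar `Q′_k` (1.20) on each component). [cite: Balaban1984PropagatorsI, (1.20) p.20] -/
def qsOp : (Tor (fine n M) × Fin (d + 1) → ℝ) →ₗ[ℝ] (Tor M × Fin (d + 1) → ℝ) where
  toFun f := fun b => ((n : ℝ) ^ (d + 1))⁻¹ * ∑ x ∈ fibre (blockOf n M) b.1, f (x, b.2)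
  map_add' f g := by funext b; simp only [Pi.add_apply, sum_add_distrib, mul_add]
  map_smul' c f := by funext b; simp only [Pi.smul_apply, smul_eq_mul, RingHom.id_apply, ← mul_sum]; ring

/-- Pointwise form. [folklore] -/
theorem qsOp_apply (f : Tor (fine n M) × Fin (d + 1) → ℝ) (b : Tor M × Fin (d + 1)) :
    qsOp M n f b = ((n : ℝ) ^ (d + 1))⁻¹ * ∑ x ∈ fibre (blockOf n M) b.1, f (x, b.2) := rfl

/-- THE BLOCK AVERAGE IS A SUP-NORM CONTRACTION. [folklore] -/
theorem norm_qsOp_le (f : Tor (fine n M) × Fin (d + 1) → ℝ) : ‖qsOp M n f‖ ≤ ‖f‖ := by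
  have hn : (0 : ℝ) < (n : ℝ) ^ (d + 1) := pow_pos (by exact_mod_cast Nat.pos_of_ne_zero (NeZero.ne n)) _
  refine (pi_norm_le_iff_of_nonneg (norm_nonneg f)).mpr fun b => ?_
  rw [qsOp_apply, Real.norm_eq_abs, abs_mul, abs_inv, abs_of_pos hn]
  calc ((n : ℝ) ^ (d + 1))⁻¹ * |∑ x ∈ fibre (blockOf n M) b.1, f (x, b.2)|
      ≤ ((n : ℝ) ^ (d + 1))⁻¹ * ∑ x ∈ fibre (blockOf n M) b.1, ‖f‖ := by
        gcongr
        exact (abs_sum_le_sum_abs _ _).trans (sum_le_sum fun x _ => by rw [← Real.norm_eq_abs]; exact norm_le_pi_norm f (x, b.2))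
    _ = ‖f‖ := by rw [sum_const, card_fibre_blockOf, nsmul_eq_mul, Nat.cast_pow, ← mul_assoc, inv_mul_cancel₀ hn.ne', one_mul]

/-- **BAŁABAN's `Q_k` ON REAL 1-FORMS** (1.18): «`(Q_kA)_b = Σ_{x∈B^k(b₋)} η^{d+1}A([x, x(b)])`» = the block average of the LINE FILTER of length `n` along the bond's own
direction — `(Q u)(y, μ) = (Q^s (A_μ(n) u))(y, μ)` with `A_μ(n) = ρ(a_μ(n))`. [cite: Balaban1984PropagatorsI, (1.18) p.20] -/
def qvRe : (Tor (fine n M) × Fin (d + 1) → ℝ) →ₗ[ℝ] (Tor M × Fin (d + 1) → ℝ) where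
  toFun u := fun b => qsOp M n (symbOp M n (sA M n b.2 n) u) b
  map_add' u v := by funext b; simp only [map_add, Pi.add_apply]
  map_smul' c u := by funext b; simp only [map_smul, Pi.smul_apply, RingHom.id_apply]

/-- Pointwise form. [folklore] -/
theorem qvRe_apply (u : Tor (fine n M) × Fin (d + 1) → ℝ) (b : Tor M × Fin (d + 1)) :
    qvRe M n u b = qsOp M n (symbOp M n (sA M n b.2 n) u) b := rfl

/-- `Q` is a sup-norm contraction. [folklore] -/
theorem norm_qvRe_le (u : Tor (fine n M) × Fin (d + 1) → ℝ) : ‖qvRe M n u‖ ≤ ‖u‖ := by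
  refine (pi_norm_le_iff_of_nonneg (norm_nonneg u)).mpr fun b => ?_
  rw [qvRe_apply]
  exact (norm_le_pi_norm _ b).trans ((norm_qsOp_le M n _).trans (norm_symbOp_sA_le M n b.2 (NeZero.ne n) u))

/-- **DICTIONARY**: the real operator `qvRe` IS b05's typed (1.18) matrix `B5Block118.QvOp n M` read on real 1-forms — through part 20's stencil
`QvOp_apply_eq` (`Q((y,μ),(x,κ)) = [κ = μ]·#{t < n : B(x − te_μ) = y}∕n^{d+2}`): reindex `x = w + te_μ` over the block `B(y) ∋ w`. [cite: Balaban1984PropagatorsI, (1.18) p.20] -/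
theorem QvOp_mulVec_ofReal_re (u : Tor (fine n M) × Fin (d + 1) → ℝ) (b : Tor M × Fin (d + 1)) :
    ((QvOp n M).mulVec (fun i => (u i : ℂ)) b).re = qvRe M n u b := by
  classical
  obtain ⟨y, μ⟩ := b
  have hn : (n : ℝ) ≠ 0 := Nat.cast_ne_zero.mpr (NeZero.ne n)
  -- the complex entry as a real count
  have hentry : ∀ i : Tor (fine n M) × Fin (d + 1), ((QvOp n M (y, μ) i) * (u i : ℂ)).re =
      (if i.2 = μ then (((univ.filter fun t : Fin n => blockOf n M (i.1 - tstep (fine n M) i.2 (t : ℕ)) = y).card : ℕ) : ℝ) /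
        (n : ℝ) ^ (d + 2) else 0) * u i := by
    rintro ⟨x, κ⟩
    rw [QvOp_apply_eq]
    split_ifs with h
    · rw [show ((((univ.filter fun t : Fin n => blockOf n M (x - tstep (fine n M) κ (t : ℕ)) = y).card : ℕ) : ℂ) / (n : ℂ) ^ (d + 2)) =
          (((((univ.filter fun t : Fin n => blockOf n M (x - tstep (fine n M) κ (t : ℕ)) = y).card : ℕ) : ℝ) / (n : ℝ) ^ (d + 2) : ℝ) : ℂ) by
          push_cast; ring, ← Complex.ofReal_mul, Complex.ofReal_re]
    · simp
  rw [Matrix.mulVec, dotProduct, Complex.re_sum, Finset.sum_congr rfl fun i _ => hentry i, Fintype.sum_prod_type_right,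
    Finset.sum_eq_single μ (fun κ _ hκ => by simp [hκ]) (fun h => absurd (mem_univ μ) h)]
  simp only [if_true]
  have hcount : ∀ x : Tor (fine n M), (((univ.filter fun t : Fin n => blockOf n M (x - tstep (fine n M) μ (t : ℕ)) = y).card : ℕ) : ℝ) =
      ∑ t : Fin n, if blockOf n M (x - tstep (fine n M) μ (t : ℕ)) = y then (1 : ℝ) else 0 := fun x => by
    rw [Finset.card_filter, Nat.cast_sum]; simp
  simp_rw [hcount, Finset.sum_div, Finset.sum_mul]
  rw [Finset.sum_comm]
  -- LHS, per `t`: reindex `x = w + t e_μ` and restrict to the block of `y`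
  have hre : ∀ t : Fin n, ∑ x : Tor (fine n M), (if blockOf n M (x - tstep (fine n M) μ (t : ℕ)) = y then (1 : ℝ) else 0) / (n : ℝ) ^ (d + 2) * u (x, μ) =
      ∑ w ∈ fibre (blockOf n M) y, ((n : ℝ) ^ (d + 1))⁻¹ * (((n : ℕ) : ℝ)⁻¹ * u (w + (t : ℕ) • unitVec (fine n M) μ, μ)) := by
    intro t
    set G : Tor (fine n M) → ℝ := fun w => (if blockOf n M w = y then (1 : ℝ) else 0) / (n : ℝ) ^ (d + 2) * u (w + (t : ℕ) • unitVec (fine n M) μ, μ)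
      with hG
    have e1 : ∑ x : Tor (fine n M), (if blockOf n M (x - tstep (fine n M) μ (t : ℕ)) = y then (1 : ℝ) else 0) / (n : ℝ) ^ (d + 2) * u (x, μ) =
        ∑ x : Tor (fine n M), G (x - tstep (fine n M) μ (t : ℕ)) :=
      sum_congr rfl fun x _ => by simp only [hG]; rw [tstep_eq_smul, sub_add_cancel]
    rw [e1, show ∑ x : Tor (fine n M), G (x - tstep (fine n M) μ (t : ℕ)) = ∑ w, G w from (Equiv.subRight (tstep (fine n M) μ (t : ℕ))).sum_comp G,
      ← Finset.sum_filter_add_sum_filter_not univ (fun w => blockOf n M w = y),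
      Finset.sum_eq_zero (s := univ.filter fun w => ¬ blockOf n M w = y) (fun w hw => by simp only [hG]; rw [if_neg (mem_filter.mp hw).2, zero_div, zero_mul]),
      add_zero]
    refine Finset.sum_congr rfl fun w hw => ?_
    simp only [hG]
    rw [if_pos ((mem_fibre _ _ _).mp hw), pow_succ]
    field_simp
  rw [Finset.sum_congr rfl fun t _ => hre t]
  -- RHS: the block average of the line filter
  rw [qvRe_apply, qsOp_apply]
  simp only [symbOp_sA_apply]
  rw [mul_sum]
  simp_rw [mul_sum]
  rw [Finset.sum_comm]
  exact Finset.sum_congr rfl fun w _ => (Finset.sum_range fun i => ((n : ℝ) ^ (d + 1))⁻¹ * (((n : ℕ) : ℝ)⁻¹ * u (w + i • unitVec (fine n M) μ, μ))).symm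

end BlockAverage

/-! ## §11 Two grids: the block average sees through King's prolongation; the unit-length line filter factorises through the coarse one -/

section TwoGrids

variable (M : Fin (d + 1) → ℕ) [∀ μ, NeZero (M μ)] (L k m : ℕ) [NeZero L]

/-- **THE FINE BLOCK AVERAGE OF A PROLONGATION IS THE COARSE BLOCK AVERAGE**: `Q′^s ∘ P = Q^s` — each coarse point has exactly `(L^m)^{d+1}` fine points over it
(`card_fibre_kingProj`), all in the same unit block (`blockOf_over`). [cite: King1986, p.664 (pairing convention «x′ ∈ B^n(x)»)] -/
theorem qsOp_comp_pull : qsOp M (L ^ m * L ^ k) ∘ₗ pull (kingPrV L k m M) = qsOp M (L ^ k) := by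
  classical
  have hLm : ((L : ℝ) ^ m) ≠ 0 := pow_ne_zero m (Nat.cast_ne_zero.mpr (NeZero.ne L))
  refine LinearMap.ext fun w => funext fun b => ?_
  rw [LinearMap.comp_apply, qsOp_apply, qsOp_apply]
  have hover : ∀ x' : Tor (fine (L ^ m * L ^ k) M), blockOf (L ^ m * L ^ k) M x' = blockOf (L ^ k) M (kingPr L k m M x') := fun x' =>
    blockOf_over M (kingPr L k m M x') x' fun μ => kingPr_val L k m M x' μ
  have hsplit : ∑ x' ∈ fibre (blockOf (L ^ m * L ^ k) M) b.1, pull (kingPrV L k m M) w (x', b.2) =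
      ∑ x ∈ fibre (blockOf (L ^ k) M) b.1, ∑ x' ∈ fibre (kingPr L k m M) x, w (x, b.2) := by
    rw [← Finset.sum_fiberwise_of_maps_to (s := fibre (blockOf (L ^ m * L ^ k) M) b.1) (t := fibre (blockOf (L ^ k) M) b.1)
      (g := kingPr L k m M) (fun x' hx' => (mem_fibre _ _ _).mpr (by rw [← hover]; exact (mem_fibre _ _ _).mp hx'))]
    refine sum_congr rfl fun x hx => ?_
    have hset : (fibre (blockOf (L ^ m * L ^ k) M) b.1).filter (fun x' => kingPr L k m M x' = x) = fibre (kingPr L k m M) x := by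
      ext x'
      simp only [mem_filter, mem_fibre]
      constructor
      · exact fun h => h.2
      · intro h; exact ⟨by rw [hover, h]; exact (mem_fibre _ _ _).mp hx, h⟩
    rw [hset]
    exact sum_congr rfl fun x' hx' => by rw [pull_apply, kingPrV_eq, (mem_fibre _ _ _).mp hx']
  rw [hsplit]
  simp_rw [sum_const, DefectKernel.card_fibre_kingProj L k m M (kingPr L k m M) (kingPr_val L k m M), nsmul_eq_mul]
  rw [← mul_sum, ← mul_assoc]
  congr 1
  push_cast
  rw [mul_pow]
  field_simp

/-- the geometric factorisation `Σ_{t<Rn} x^t = (Σ_{s<n}(x^R)^s)·(Σ_{r<R} x^r)`. [folklore] -/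
theorem sum_range_mul_pow {A : Type} [CommSemiring A] (x : A) (R n : ℕ) :
    ∑ t ∈ range (R * n), x ^ t = (∑ s ∈ range n, (x ^ R) ^ s) * ∑ r ∈ range R, x ^ r := by
  induction n with
  | zero => simp
  | succ n ih =>
      rw [Nat.mul_succ, sum_range_add, ih, sum_range_succ, add_mul]
      congr 1
      rw [mul_sum]
      exact sum_congr rfl fun r _ => by rw [pow_add, pow_mul]

omit [∀ μ, NeZero (M μ)] [NeZero L] in
/-- **THE UNIT-LENGTH LINE FILTER ON THE FINE LATTICE FACTORISES**: `a′_μ(L^mL^k) = a′_μ(L^m)·[(L^k)⁻¹Σ_{s<L^k}(s′_μ^{L^m})^s]` — the box filter of ONE coarse step times the coarse line filter pushed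
through King's pairing. [folklore] -/
theorem sA_unit_eq (μ : Fin (d + 1)) :
    sA M (L ^ m * L ^ k) μ (L ^ m * L ^ k) =
      sA M (L ^ m * L ^ k) μ (L ^ m) * (((L ^ k : ℕ) : ℝ)⁻¹ • ∑ s ∈ range (L ^ k), (sT M (L ^ m * L ^ k) μ ^ L ^ m) ^ s) := by
  rw [sA, sA, sum_range_mul_pow, smul_mul_smul_comm, Nat.cast_mul, mul_inv,
    mul_comm (∑ s ∈ range (L ^ k), (sT M (L ^ m * L ^ k) μ ^ L ^ m) ^ s)]

/-- the pushed-through coarse line filter intertwines with the coarse line filter: `ρ′((L^k)⁻¹Σ_s(s′^{L^m})^s)∘P = P∘ρ(a_μ(L^k))`. [folklore] -/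
theorem symbOp_pushedLine_comp_pull (μ : Fin (d + 1)) :
    symbOp M (L ^ m * L ^ k) (((L ^ k : ℕ) : ℝ)⁻¹ • ∑ s ∈ range (L ^ k), (sT M (L ^ m * L ^ k) μ ^ L ^ m) ^ s) ∘ₗ pull (kingPrV L k m M) =
      pull (kingPrV L k m M) ∘ₗ symbOp M (L ^ k) (sA M (L ^ k) μ (L ^ k)) :=
  comp_pull_smul M L k m _ (comp_pull_sum M L k m (range (L ^ k)) fun s _ => comp_pull_pow M L k m (symbOp_sT_pow_comp_pull M L k m μ) s)

/-- ★ **THE TWO-GRID CONSISTENCY OF BAŁABAN's `Q_k`, EXACTLY**: `(Q′Pu)(y, μ) − (Qu)(y, μ) = Q′^s[(A′_μ(L^m) − 1)·P(A_μ(L^k)u)](y, μ)` — the fine averaging of a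
prolongated field differs from the coarse averaging by the ONE-COARSE-STEP box-filter defect of the prolongated coarse line filter. [cite: Balaban1984PropagatorsI, (1.18) p.20] -/
theorem qvRe_pull_sub_apply (u : Tor (fine (L ^ k) M) × Fin (d + 1) → ℝ) (b : Tor M × Fin (d + 1)) :
    qvRe M (L ^ m * L ^ k) (pull (kingPrV L k m M) u) b - qvRe M (L ^ k) u b =
      qsOp M (L ^ m * L ^ k) (symbOp M (L ^ m * L ^ k) (sA M (L ^ m * L ^ k) b.2 (L ^ m) - 1)
        (pull (kingPrV L k m M) (symbOp M (L ^ k) (sA M (L ^ k) b.2 (L ^ k)) u))) b := by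
  have h1 : symbOp M (L ^ m * L ^ k) (sA M (L ^ m * L ^ k) b.2 (L ^ m * L ^ k)) (pull (kingPrV L k m M) u) =
      symbOp M (L ^ m * L ^ k) (sA M (L ^ m * L ^ k) b.2 (L ^ m)) (pull (kingPrV L k m M) (symbOp M (L ^ k) (sA M (L ^ k) b.2 (L ^ k)) u)) := by
    have h := LinearMap.congr_fun (symbOp_pushedLine_comp_pull M L k m b.2) u
    simp only [LinearMap.comp_apply] at h
    rw [sA_unit_eq, map_mul, Module.End.mul_apply, h]
  have h2 : qvRe M (L ^ k) u b = qsOp M (L ^ m * L ^ k) (pull (kingPrV L k m M) (symbOp M (L ^ k) (sA M (L ^ k) b.2 (L ^ k)) u)) b := by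
    rw [qvRe_apply, ← qsOp_comp_pull M L k m, LinearMap.comp_apply]
  rw [qvRe_apply, h1, h2, map_sub, map_one, LinearMap.sub_apply, Module.End.one_apply, map_sub, Pi.sub_apply]

/-- ★ **… AND ITS SIZE: ONE COARSE DIFFERENCE** — `‖Q′(Pu) − Qu‖_∞ ≤ Σ_ν ‖(τ_ν − 1)u‖_∞` (at `u = G₀λ`: `(d+1)·η·sup|∇G₀λ|`, the (1.110) gradient entry), uniformly in
`m`. [cite: Balaban1984PropagatorsI, (1.18) p.20, Prop. 1.2 (1.110) p.34 (the consumer's shape)] -/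
theorem norm_qvRe_pull_sub_le (u : Tor (fine (L ^ k) M) × Fin (d + 1) → ℝ) :
    ‖qvRe M (L ^ m * L ^ k) (pull (kingPrV L k m M) u) - qvRe M (L ^ k) u‖ ≤ ∑ ν : Fin (d + 1), ‖symbOp M (L ^ k) (sT M (L ^ k) ν - 1) u‖ := by
  refine (pi_norm_le_iff_of_nonneg (sum_nonneg fun ν _ => norm_nonneg _)).mpr fun b => ?_
  rw [Pi.sub_apply, qvRe_pull_sub_apply]
  refine (norm_le_pi_norm _ b).trans ((norm_qsOp_le M (L ^ m * L ^ k) _).trans ?_)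
  refine (norm_symbOp_sA_sub_one_pull_le M L k m b.2 _).trans ?_
  have hcomm : symbOp M (L ^ k) (sT M (L ^ k) b.2 - 1) (symbOp M (L ^ k) (sA M (L ^ k) b.2 (L ^ k)) u) =
      symbOp M (L ^ k) (sA M (L ^ k) b.2 (L ^ k)) (symbOp M (L ^ k) (sT M (L ^ k) b.2 - 1) u) := by
    rw [← Module.End.mul_apply, ← map_mul, mul_comm, map_mul, Module.End.mul_apply]
  rw [hcomm]
  exact (norm_symbOp_sA_le M (L ^ k) b.2 (pow_ne_zero k (NeZero.ne L)) _).trans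
    (single_le_sum (f := fun ν => ‖symbOp M (L ^ k) (sT M (L ^ k) ν - 1) u‖) (fun ν _ => norm_nonneg _) (mem_univ b.2))

end TwoGrids

/-! ## §12 The adjoint `Q*_k` as the line-weight stencil and its two-grid consistency -/

section Adjoint

variable (M : Fin (d + 1) → ℕ) [∀ μ, NeZero (M μ)] (n : ℕ) [NeZero n]

/-- **BAŁABAN's `Q*_k` ON REAL 1-FORMS** (the adjoint of (1.18) for the `η^{d+1}`-weighted pairing, `B5DeltaA169.QvAdj = n^{d+1}·Q_kᴴ`): the LINE-WEIGHT STENCIL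
`(Q*v)(x, κ) = Σ_z θ_n(x, z; κ)·v(z, κ)` of part 20 (`lineWeight`; weights in `[0, 1]`, supported on the two blocks `B(x)`, `B(x) − e_κ`). [cite: Balaban1984PropagatorsI, (1.18) p.20, (1.69) p.29 (Q*)] -/
def qvAdjRe : (Tor M × Fin (d + 1) → ℝ) →ₗ[ℝ] (Tor (fine n M) × Fin (d + 1) → ℝ) where
  toFun v := fun i => ∑ z : Tor M, lineWeight n M i.2 i.1 z * v (z, i.2)
  map_add' v w := by funext i; simp only [Pi.add_apply, mul_add, sum_add_distrib]
  map_smul' c v := by funext i; simp only [Pi.smul_apply, smul_eq_mul, RingHom.id_apply, mul_sum]; exact sum_congr rfl fun z _ => by ring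

/-- Pointwise form. [folklore] -/
theorem qvAdjRe_apply (v : Tor M × Fin (d + 1) → ℝ) (i : Tor (fine n M) × Fin (d + 1)) :
    qvAdjRe M n v i = ∑ z : Tor M, lineWeight n M i.2 i.1 z * v (z, i.2) := rfl

/-- **DICTIONARY**: `qvAdjRe` IS b05's `QvAdj n M = n^{d+1}·(QvOp n M)ᴴ` read on real 1-forms (part 20's `QvOp_re_eq_lineWeight`, `QvOp_im_eq_zero`). [cite: Balaban1984PropagatorsI, (1.18) p.20] -/
theorem QvAdj_mulVec_ofReal_re (v : Tor M × Fin (d + 1) → ℝ) (i : Tor (fine n M) × Fin (d + 1)) :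
    ((QvAdj n M).mulVec (fun b => (v b : ℂ)) i).re = qvAdjRe M n v i := by
  obtain ⟨x, κ⟩ := i
  have hentry : ∀ b : Tor M × Fin (d + 1), (((n : ℂ) ^ (d + 1) * star (QvOp n M b (x, κ))) * (v b : ℂ)).re =
      (if κ = b.2 then lineWeight n M κ x b.1 else 0) * v b := by
    rintro ⟨z, ι⟩
    have him := VectorPiece.QvOp_im_eq_zero n M z ι x κ
    have hre := QvOp_re_eq_lineWeight n M z ι x κ
    have hq : QvOp n M (z, ι) (x, κ) = (((QvOp n M (z, ι) (x, κ)).re : ℝ) : ℂ) := by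
      rw [Complex.ext_iff]; simp [him]
    rw [hq, Complex.star_def, Complex.conj_ofReal, show ((n : ℂ) ^ (d + 1)) = (((n : ℝ) ^ (d + 1) : ℝ) : ℂ) by push_cast; ring, ← Complex.ofReal_mul,
      ← Complex.ofReal_mul, Complex.ofReal_re, mul_comm ((n : ℝ) ^ (d + 1)), hre]
  rw [QvAdj, Matrix.smul_mulVec, Pi.smul_apply, Matrix.mulVec, dotProduct, smul_eq_mul, mul_sum, Complex.re_sum]
  simp_rw [← mul_assoc, Matrix.conjTranspose_apply]
  rw [Finset.sum_congr rfl fun b _ => hentry b, qvAdjRe_apply, Fintype.sum_prod_type_right,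
    Finset.sum_eq_single κ (fun ι _ hι => by simp [Ne.symm hι]) (fun h => absurd (mem_univ κ) h)]
  simp

/-- THE STENCIL WEIGHTS SUM TO ONE: `Σ_z θ_n(x, z; κ) = 1` (each of the `n` backward line points lies in exactly one block). [cite: Balaban1984PropagatorsI, (1.18) p.20] -/
theorem sum_lineWeight (κ : Fin (d + 1)) (x : Tor (fine n M)) : ∑ z : Tor M, lineWeight n M κ x z = 1 := by
  classical
  have hn : (n : ℝ) ≠ 0 := Nat.cast_ne_zero.mpr (NeZero.ne n)
  unfold lineWeight
  rw [← sum_div, div_eq_one_iff_eq hn, ← Nat.cast_sum]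
  have h : ∑ z : Tor M, ((univ.filter fun t : Fin n => blockOf n M (x - tstep (fine n M) κ (t : ℕ)) = z).card) = n := by
    rw [← Finset.card_eq_sum_card_fiberwise (f := fun t : Fin n => blockOf n M (x - tstep (fine n M) κ (t : ℕ))) (s := univ) (t := univ)
      fun _ _ => mem_univ _, card_univ, Fintype.card_fin]
  exact_mod_cast h

/-- `Q*` IS A SUP-NORM CONTRACTION (weights in `[0, 1]` summing to `1`). [folklore] -/
theorem norm_qvAdjRe_le (v : Tor M × Fin (d + 1) → ℝ) : ‖qvAdjRe M n v‖ ≤ ‖v‖ := by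
  refine (pi_norm_le_iff_of_nonneg (norm_nonneg v)).mpr fun i => ?_
  rw [qvAdjRe_apply, Real.norm_eq_abs]
  refine (abs_sum_le_sum_abs _ _).trans ?_
  calc ∑ z : Tor M, |lineWeight n M i.2 i.1 z * v (z, i.2)| ≤ ∑ z : Tor M, lineWeight n M i.2 i.1 z * ‖v‖ :=
        sum_le_sum fun z _ => by
          rw [abs_mul, abs_of_nonneg (lineWeight_nonneg n M i.2 i.1 z)]
          exact mul_le_mul_of_nonneg_left (by rw [← Real.norm_eq_abs]; exact norm_le_pi_norm v (z, i.2)) (lineWeight_nonneg n M i.2 i.1 z)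
    _ = ‖v‖ := by rw [← sum_mul, sum_lineWeight, one_mul]

variable (L k m : ℕ) [NeZero L]

/-- every fine point is a block point `x = n·B(x) + a` (King's `site` = b05's `bpt`). [folklore] -/
theorem exists_eq_bpt_blockOf (x : Tor (fine n M)) : ∃ a : Fin (d + 1) → Fin n, x = bpt n M (blockOf n M x) a := by
  obtain ⟨j, hj⟩ := (mem_fibre_blockOf_iff n M (blockOf n M x) x).mp ((mem_fibre _ _ _).mpr rfl)
  exact ⟨j, hj.trans (site_eq_bpt n M _ j)⟩

/-- ★ **THE TWO-GRID CONSISTENCY OF `Q*_k`**: `‖Q′*v − P(Q*v)‖_∞ ≤ (2∕L^k)·‖v‖_∞ = 2η‖v‖` — the fine and the coarse stencils weight the SAME two unit blocks with weights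
differing by at most `1∕L^k` (part 20's `abs_lineWeight_pair_sub_le` through King's pairing `pr(L^mL^k·y + a′) = L^k·y + ⌊a′∕L^m⌋`). [cite: Balaban1984PropagatorsI, (1.18) p.20; King1986, p.664 (the pairing)] -/
theorem norm_qvAdjRe_sub_pull_le (v : Tor M × Fin (d + 1) → ℝ) :
    ‖qvAdjRe M (L ^ m * L ^ k) v - pull (kingPrV L k m M) (qvAdjRe M (L ^ k) v)‖ ≤ 2 / (L : ℝ) ^ k * ‖v‖ := by
  classical
  have hL : (0 : ℝ) < L := by exact_mod_cast Nat.pos_of_ne_zero (NeZero.ne L)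
  have hLk : (0 : ℝ) < (L : ℝ) ^ k := pow_pos hL k
  refine (pi_norm_le_iff_of_nonneg (mul_nonneg (div_nonneg zero_le_two hLk.le) (norm_nonneg v))).mpr fun i => ?_
  obtain ⟨x', κ⟩ := i
  obtain ⟨a', hx'⟩ := exists_eq_bpt_blockOf M (L ^ m * L ^ k) x'
  set y := blockOf (L ^ m * L ^ k) M x' with hy
  let ah : Fin (d + 1) → Fin (L ^ k) := fun ν => ⟨(a' ν : ℕ) / L ^ m, Nat.div_lt_of_lt_mul (a' ν).isLt⟩
  have hpr : kingPr L k m M x' = bpt (L ^ k) M y ah := by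
    rw [hx']; exact pr_bpt (L ^ m) (L ^ k) M (kingPr L k m M) (kingPr_val L k m M) y a' ah fun _ => rfl
  rw [Pi.sub_apply, pull_apply, kingPrV_eq, qvAdjRe_apply, qvAdjRe_apply, Real.norm_eq_abs]
  simp only
  rw [hpr, ← sum_sub_distrib]
  have hw : ∀ z : Tor M, |lineWeight (L ^ m * L ^ k) M κ x' z * v (z, κ) - lineWeight (L ^ k) M κ (bpt (L ^ k) M y ah) z * v (z, κ)| ≤
      ((if z = y then 1 else 0) + (if z + unitVec M κ = y then 1 else 0)) / ((L ^ k : ℕ) : ℝ) * ‖v‖ := fun z => by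
    rw [← sub_mul, abs_mul]
    refine mul_le_mul ?_ (by rw [← Real.norm_eq_abs]; exact norm_le_pi_norm v (z, κ)) (abs_nonneg _) (by positivity)
    rw [hx']
    exact abs_lineWeight_pair_sub_le (L ^ k) M (L ^ m) y z a' ah (fun _ => rfl) κ
  refine (abs_sum_le_sum_abs _ _).trans ((sum_le_sum fun z _ => hw z).trans ?_)
  rw [← sum_mul, ← sum_div, sum_add_distrib, sum_ite_eq' univ y, if_pos (mem_univ y)]
  have h2 : ∑ z : Tor M, (if z + unitVec M κ = y then (1 : ℝ) else 0) = 1 := by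
    rw [show (fun z : Tor M => if z + unitVec M κ = y then (1 : ℝ) else 0) = fun z => if z = y - unitVec M κ then 1 else 0 from
      funext fun z => by simp only [eq_sub_iff_add_eq], sum_ite_eq' univ, if_pos (mem_univ _)]
  rw [h2, Nat.cast_pow]
  norm_num

end Adjoint

end Summit.QuantumFields.YangMills.BalabanUVNodes.N15.TwoGrid
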